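import Summits.AtomisticToContinuum.Crystallization.Theorems.FrustratedLawDichotomyStrainedPatchHomGram
import Summits.AtomisticToContinuum.Crystallization.Theorems.FrustratedLawDichotomyStrainedPatchHomTermCalculusSq

/-!
# Leaf soundness with TABLE-POINT expansion, interval gradients WITH cross-label cancellation, and the near/far label split (def-free)

decomp-a2c hand-1 g20 (crux `AperiodicFrustratedLawGap`, stmt-AtomisticToContinuum-27623; critic row 799 (c) «TABULATE … plus a SEMANTIC variant
of the bridge»).  This is the semantic layer under a table-driven reflected checker for the (P4) fcc Gram leaves of the `HomFloor` certificate: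

* §2 `leaf_sound_points` — the centred form of `…HomCentredForm.leaf_sound`, but (i) every term is expanded at an ARBITRARY point `p_v` of its range
  (a grid point of a once-certified `q`-table, so no per-leaf enclosure arithmetic is needed), (ii) the value / derivative at `p_v` enter only through
  certified bounds `V_v ≤ φ_v(p_v)`, `φ_v′(p_v) ∈ [Dlo_v, Dhi_v]`, and (iii) the gradient term is bounded coordinate-wise by INTERVAL SUMS TAKEN BEFORE
  THE ABSOLUTE VALUE, `Σ_i max |Σ_v min(Dlo_v L_vi)(Dhi_v L_vi)| |Σ_v max(Dlo_v L_vi)(Dhi_v L_vi)|·w_i`, which keeps the cancellation of the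
  Gram stress `Σ_v φ_v′ L_vi` across labels (CERT-DESIGN-g44 §3: the per-label absolute value is the «hopeless» natural extension);
* §3 `boxSum_ge_of_nearPoints` — the (P4) fcc instance for the record potential `W₄₅`: the box sum over `[−7,7]³ ∖ 0` is bounded from a HALF-SET `S` of
  near labels (one per `±` pair: `‖latPt G f (−b)‖ = ‖latPt G f b‖`) with all remaining labels FAR (`9/2 ≤ ‖latPt G f b‖`, where `W₄₅ = 0`), so a
  checker only visits `S`.

No definitions; 0 sorry; standard axioms.  `--supports stmt-AtomisticToContinuum-27623`.
-/

noncomputable section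

namespace Summit.AtomisticToContinuum.Crystallization.Theorems.FrustratedLawDichotomyStrainedPatchHomLeafPoints

open scoped BigOperators RealInnerProductSpace
open Set Finset
open Summit.AtomisticToContinuum.Crystallization.Theorems.ChargedEnergyGapNegative (E3)
open Summit.AtomisticToContinuum.Crystallization.Theorems.FrustratedLawDichotomySchurCut (effPot w₄₅ ω₄)
open Summit.AtomisticToContinuum.Crystallization.Theorems.FrustratedLawDichotomyStrainedPatchHomSplit (latPt)
open Summit.AtomisticToContinuum.Crystallization.Theorems.FrustratedLawDichotomyStrainedPatchHomCentredForm
open Summit.AtomisticToContinuum.Crystallization.Theorems.FrustratedLawDichotomyStrainedPatchHomGram (summand_eq_gram)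
open Summit.AtomisticToContinuum.Crystallization.Theorems.FrustratedLawDichotomyStrainedPatchHomLattice (latPt_neg)
open Summit.AtomisticToContinuum.Crystallization.Theorems.FrustratedLawDichotomyStrainedPatchHomTermCalculus
  (hasDerivAt_phi45 effPot45_eq_far)

/-! ## §1. Two order lemmas -/

/-- `x ∈ [a, b]` ⟹ `min (a·t) (b·t) ≤ x·t` (any sign of `t`). [folklore] -/
theorem min_mul_le_of_mem {x a b t : ℝ} (h : x ∈ Icc a b) : min (a * t) (b * t) ≤ x * t := by
  rcases le_or_gt 0 t with ht | ht
  · exact (min_le_left _ _).trans (mul_le_mul_of_nonneg_right h.1 ht)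
  · exact (min_le_right _ _).trans (mul_le_mul_of_nonpos_right h.2 ht.le)

/-- `x ∈ [a, b]` ⟹ `x·t ≤ max (a·t) (b·t)` (any sign of `t`). [folklore] -/
theorem mul_le_max_of_mem {x a b t : ℝ} (h : x ∈ Icc a b) : x * t ≤ max (a * t) (b * t) := by
  rcases le_or_gt 0 t with ht | ht
  · exact (mul_le_mul_of_nonneg_right h.2 ht).trans (le_max_right _ _)
  · exact (mul_le_mul_of_nonpos_right h.1 ht.le).trans (le_max_left _ _)

/-! ## §2. Leaf soundness, points form -/

/-- ★★ **LEAF SOUNDNESS, POINTS FORM.**  `x c = Σ_{v ∈ S} φᵥ(ℓᵥ c)`, `ℓᵥ c = Σᵢ Lᵥᵢ cᵢ`, box `|cᵢ − c₀ᵢ| ≤ wᵢ`, `ℓ₀ᵥ := ℓᵥ c₀`, `rᵥ := Σᵢ |Lᵥᵢ| wᵢ`.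
Per term: a range `[loᵥ, hiᵥ] ⊇ [ℓ₀ᵥ − rᵥ, ℓ₀ᵥ + rᵥ]` on which `φᵥ` has derivative `φᵥ′` with `φᵥ′ + Mᵥ·id` monotone (`Mᵥ ≥ 0`), an expansion point
`pᵥ ∈ [loᵥ, hiᵥ]`, and certified data `Vᵥ ≤ φᵥ(pᵥ)`, `φᵥ′(pᵥ) ∈ [Dloᵥ, Dhiᵥ]`.  If
`m ≤ Σᵥ Vᵥ + Σᵥ min(Dloᵥ δᵥ)(Dhiᵥ δᵥ) − Σᵢ max |Σᵥ min(Dloᵥ Lᵥᵢ)(Dhiᵥ Lᵥᵢ)| |Σᵥ max(Dloᵥ Lᵥᵢ)(Dhiᵥ Lᵥᵢ)|·wᵢ − ½ Σᵥ Mᵥ (|δᵥ| + rᵥ)²`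
(`δᵥ := ℓ₀ᵥ − pᵥ`), then `m ≤ x c` on the whole box. [folklore: tangent parabola at `pᵥ` + interval bookkeeping] -/
theorem leaf_sound_points {ι : Type*} (S : Finset ι) {n : ℕ} (L : ι → Fin n → ℝ) (φ φ' : ι → ℝ → ℝ)
    (lo hi M p V Dlo Dhi : ι → ℝ) (c₀ w : Fin n → ℝ) (m : ℝ) (hw : ∀ i, 0 ≤ w i) (hM : ∀ v ∈ S, 0 ≤ M v)
    (hd : ∀ v ∈ S, ∀ t ∈ Icc (lo v) (hi v), HasDerivAt (φ v) (φ' v t) t)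
    (hmono : ∀ v ∈ S, MonotoneOn (fun t => φ' v t + M v * t) (Icc (lo v) (hi v)))
    (hp : ∀ v ∈ S, p v ∈ Icc (lo v) (hi v))
    (hlo : ∀ v ∈ S, lo v ≤ ∑ i, L v i * c₀ i - ∑ i, |L v i| * w i)
    (hhi : ∀ v ∈ S, ∑ i, L v i * c₀ i + ∑ i, |L v i| * w i ≤ hi v)
    (hV : ∀ v ∈ S, V v ≤ φ v (p v)) (hD : ∀ v ∈ S, φ' v (p v) ∈ Icc (Dlo v) (Dhi v))
    (hcheck : m ≤ ∑ v ∈ S, V v + ∑ v ∈ S, min (Dlo v * (∑ i, L v i * c₀ i - p v)) (Dhi v * (∑ i, L v i * c₀ i - p v))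
        - ∑ i, max |∑ v ∈ S, min (Dlo v * L v i) (Dhi v * L v i)| |∑ v ∈ S, max (Dlo v * L v i) (Dhi v * L v i)| * w i
        - 1 / 2 * ∑ v ∈ S, M v * (|∑ i, L v i * c₀ i - p v| + ∑ i, |L v i| * w i) ^ 2)
    (c : Fin n → ℝ) (hbox : ∀ i, |c i - c₀ i| ≤ w i) :
    m ≤ ∑ v ∈ S, φ v (∑ i, L v i * c i) := by
  -- abbreviations
  set ℓ : ι → ℝ := fun v => ∑ i, L v i * c i with hℓ
  set ℓ₀ : ι → ℝ := fun v => ∑ i, L v i * c₀ i with hℓ₀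
  set r : ι → ℝ := fun v => ∑ i, |L v i| * w i with hr
  set d : ι → ℝ := fun v => φ' v (p v) with hdφ
  -- every term's value over the box lies in its certified range
  have hrange : ∀ v ∈ S, ℓ v ∈ Icc (lo v) (hi v) := by
    intro v hv
    have h := linear_mem_Icc_of_box (L v) c c₀ w hbox
    exact ⟨(hlo v hv).trans h.1, h.2.trans (hhi v hv)⟩
  -- (0) tangent parabolas at the expansion points, summed
  have htan : ∑ v ∈ S, (φ v (p v) + d v * (ℓ v - p v) - M v / 2 * (ℓ v - p v) ^ 2) ≤ ∑ v ∈ S, φ v (ℓ v) :=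
    Finset.sum_le_sum fun v hv => tangent_parabola_le (hp v hv) (hrange v hv) (hd v hv) (hmono v hv)
  -- (1) values
  have hval : ∑ v ∈ S, V v ≤ ∑ v ∈ S, φ v (p v) := Finset.sum_le_sum hV
  -- (2) linear part: split `ℓ v − p v = (ℓ₀ v − p v) + Σ_i L v i (c i − c₀ i)` and regroup the second piece by coordinates
  have hsplit : ∀ v, ℓ v - p v = (ℓ₀ v - p v) + ∑ i, L v i * (c i - c₀ i) := by
    intro v
    simp only [hℓ, hℓ₀, mul_sub, Finset.sum_sub_distrib]
    ring
  have hlin_eq : ∑ v ∈ S, d v * (ℓ v - p v) = ∑ v ∈ S, d v * (ℓ₀ v - p v) + ∑ i, (∑ v ∈ S, d v * L v i) * (c i - c₀ i) := by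
    have : ∀ v ∈ S, d v * (ℓ v - p v) = d v * (ℓ₀ v - p v) + ∑ i, d v * L v i * (c i - c₀ i) := by
      intro v _
      rw [hsplit, mul_add, Finset.mul_sum]
      refine congrArg _ (Finset.sum_congr rfl fun i _ => by ring)
    rw [Finset.sum_congr rfl this, Finset.sum_add_distrib, Finset.sum_comm]
    refine congrArg _ (Finset.sum_congr rfl fun i _ => by rw [Finset.sum_mul])
  have hlin1 : ∑ v ∈ S, min (Dlo v * (ℓ₀ v - p v)) (Dhi v * (ℓ₀ v - p v)) ≤ ∑ v ∈ S, d v * (ℓ₀ v - p v) :=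
    Finset.sum_le_sum fun v hv => min_mul_le_of_mem (hD v hv)
  have hg : ∀ i, |∑ v ∈ S, d v * L v i| ≤
      max |∑ v ∈ S, min (Dlo v * L v i) (Dhi v * L v i)| |∑ v ∈ S, max (Dlo v * L v i) (Dhi v * L v i)| := fun i =>
    abs_le_max_abs_abs (Finset.sum_le_sum fun v hv => min_mul_le_of_mem (hD v hv))
      (Finset.sum_le_sum fun v hv => mul_le_max_of_mem (hD v hv))
  have hlin2 : -∑ i, max |∑ v ∈ S, min (Dlo v * L v i) (Dhi v * L v i)| |∑ v ∈ S, max (Dlo v * L v i) (Dhi v * L v i)| * w i ≤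
      ∑ i, (∑ v ∈ S, d v * L v i) * (c i - c₀ i) := by
    have h1 := neg_sum_abs_mul_le_linear (fun i => ∑ v ∈ S, d v * L v i) c c₀ w hbox
    have h2 : ∑ i, |∑ v ∈ S, d v * L v i| * w i ≤
        ∑ i, max |∑ v ∈ S, min (Dlo v * L v i) (Dhi v * L v i)| |∑ v ∈ S, max (Dlo v * L v i) (Dhi v * L v i)| * w i :=
      Finset.sum_le_sum fun i _ => mul_le_mul_of_nonneg_right (hg i) (hw i)
    linarith
  -- (3) quadratic part: `|ℓ v − p v| ≤ |ℓ₀ v − p v| + r v`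
  have hquad : ∑ v ∈ S, M v / 2 * (ℓ v - p v) ^ 2 ≤ 1 / 2 * ∑ v ∈ S, M v * (|ℓ₀ v - p v| + r v) ^ 2 := by
    rw [Finset.mul_sum]
    refine Finset.sum_le_sum fun v hv => ?_
    have h1 : |ℓ v - ℓ₀ v| ≤ r v := abs_linear_sub_le (L v) c c₀ w hbox
    have h2 : |ℓ v - p v| ≤ |ℓ₀ v - p v| + r v := by
      calc |ℓ v - p v| = |(ℓ v - ℓ₀ v) + (ℓ₀ v - p v)| := by ring_nf
        _ ≤ |ℓ v - ℓ₀ v| + |ℓ₀ v - p v| := abs_add_le _ _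
        _ ≤ |ℓ₀ v - p v| + r v := by linarith
    have h0 : 0 ≤ |ℓ₀ v - p v| + r v := (abs_nonneg _).trans h2
    have hsq : (ℓ v - p v) ^ 2 ≤ (|ℓ₀ v - p v| + r v) ^ 2 := by
      calc (ℓ v - p v) ^ 2 = |ℓ v - p v| ^ 2 := (sq_abs _).symm
        _ ≤ _ := pow_le_pow_left₀ (abs_nonneg _) h2 2
    have := mul_le_mul_of_nonneg_left hsq (hM v hv)
    linarith
  -- (4) assemble
  have hsum : ∑ v ∈ S, (φ v (p v) + d v * (ℓ v - p v) - M v / 2 * (ℓ v - p v) ^ 2)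
      = ∑ v ∈ S, φ v (p v) + ∑ v ∈ S, d v * (ℓ v - p v) - ∑ v ∈ S, M v / 2 * (ℓ v - p v) ^ 2 := by
    rw [← Finset.sum_add_distrib, ← Finset.sum_sub_distrib]
  have hcheck' : m ≤ ∑ v ∈ S, V v + ∑ v ∈ S, min (Dlo v * (ℓ₀ v - p v)) (Dhi v * (ℓ₀ v - p v))
      - ∑ i, max |∑ v ∈ S, min (Dlo v * L v i) (Dhi v * L v i)| |∑ v ∈ S, max (Dlo v * L v i) (Dhi v * L v i)| * w i
      - 1 / 2 * ∑ v ∈ S, M v * (|ℓ₀ v - p v| + r v) ^ 2 := by simpa only [hℓ₀, hr] using hcheck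
  have htan' : ∑ v ∈ S, (φ v (p v) + d v * (ℓ v - p v) - M v / 2 * (ℓ v - p v) ^ 2) ≤ ∑ v ∈ S, φ v (∑ i, L v i * c i) := by
    simpa only [hℓ] using htan
  linarith [htan', hsum, hval, hlin_eq, hlin1, hlin2, hquad, hcheck']

/-! ## §3. The (P4) fcc instance for `W₄₅`, with the `±` folding and far labels -/

/-- `‖latPt G f (−b)‖ = ‖latPt G f b‖`. [formal bookkeeping] -/
theorem norm_latPt_neg (G : E3 →L[ℝ] E3) (f : Fin 3 → E3) (b : Fin 3 → ℤ) : ‖latPt G f (-b)‖ = ‖latPt G f b‖ := by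
  rw [latPt_neg, norm_neg]

/-- The label box `[−7,7]³ ∖ 0` is symmetric under `b ↦ −b`. [formal bookkeeping] -/
theorem neg_mem_box7 {b : Fin 3 → ℤ} (hb : b ∈ (Fintype.piFinset fun _ : Fin 3 => Finset.Icc (-7 : ℤ) 7).filter (fun b => b ≠ 0)) :
    -b ∈ (Fintype.piFinset fun _ : Fin 3 => Finset.Icc (-7 : ℤ) 7).filter (fun b => b ≠ 0) := by
  simp only [Finset.mem_filter, Fintype.mem_piFinset, Finset.mem_Icc, Pi.neg_apply] at hb ⊢
  refine ⟨fun i => ⟨by linarith [(hb.1 i).2], by linarith [(hb.1 i).1]⟩, fun h => hb.2 (neg_eq_zero.1 h)⟩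

/-- **Near/far split with `±` folding.**  For `S ⊆ box` disjoint from `−S`, a summand `F` with `F(−b) = F b`, and `F = 0` on the labels of the box
outside `S ∪ −S`: `Σ_{b ∈ box} F b = 2 · Σ_{b ∈ S} F b`. [formal bookkeeping] -/
theorem sum_box7_eq_two_mul_sum (S : Finset (Fin 3 → ℤ)) (F : (Fin 3 → ℤ) → ℝ)
    (hS : S ⊆ (Fintype.piFinset fun _ : Fin 3 => Finset.Icc (-7 : ℤ) 7).filter (fun b => b ≠ 0))
    (hdisj : ∀ b ∈ S, -b ∉ S) (hF : ∀ b, F (-b) = F b)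
    (hzero : ∀ b ∈ (Fintype.piFinset fun _ : Fin 3 => Finset.Icc (-7 : ℤ) 7).filter (fun b => b ≠ 0), b ∉ S → -b ∉ S → F b = 0) :
    ∑ b ∈ (Fintype.piFinset fun _ : Fin 3 => Finset.Icc (-7 : ℤ) 7).filter (fun b => b ≠ 0), F b = 2 * ∑ b ∈ S, F b := by
  classical
  set box := (Fintype.piFinset fun _ : Fin 3 => Finset.Icc (-7 : ℤ) 7).filter (fun b => b ≠ 0) with hboxdef
  set T : Finset (Fin 3 → ℤ) := S.image (fun b => -b) with hT
  have hTsub : T ⊆ box \ S := by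
    intro x hx
    obtain ⟨b, hb, rfl⟩ := Finset.mem_image.1 hx
    exact Finset.mem_sdiff.2 ⟨neg_mem_box7 (hS hb), hdisj b hb⟩
  have h1 : ∑ b ∈ box, F b = ∑ b ∈ S, F b + ∑ b ∈ box \ S, F b := (Finset.sum_sdiff hS).symm.trans (by rw [add_comm])
  have h2 : ∑ b ∈ box \ S, F b = ∑ b ∈ T, F b + ∑ b ∈ (box \ S) \ T, F b := (Finset.sum_sdiff hTsub).symm.trans (by rw [add_comm])
  have h3 : ∑ b ∈ (box \ S) \ T, F b = 0 := by
    refine Finset.sum_eq_zero fun b hb => ?_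
    simp only [Finset.mem_sdiff] at hb
    refine hzero b hb.1.1 hb.1.2 fun h => hb.2 ?_
    exact Finset.mem_image.2 ⟨-b, h, neg_neg b⟩
  have h4 : ∑ b ∈ T, F b = ∑ b ∈ S, F b := by
    rw [hT, Finset.sum_image fun x _ y _ h => neg_injective h]
    exact Finset.sum_congr rfl fun b _ => hF b
  rw [h1, h2, h3, h4]; ring

/-- ★★★ **THE (P4) fcc GRAM LEAF FROM NEAR-LABEL POINT DATA.**  `S` = a half-set of near labels (`S ⊆ [−7,7]³∖0`, `−S ∩ S = ∅`); Gram box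
`|⟪G fᵢ, G fⱼ⟫ − c₀ₖ| ≤ wₖ` (`k : Fin 9 ≃ Fin 3 × Fin 3`, `L_b k = bᵢbⱼ`); per `b ∈ S`: a range `[lo_b, hi_b]` with `0 < lo_b` containing the box range of
`q_b = Σₖ L_bk cₖ` and the expansion point `p_b`, a curvature constant `M_b ≥ 0` (`φ′ + M_b·id` monotone on the range, `φ = W₄₅ ∘ √`), and certified point
data `V_b ≤ φ(p_b)`, `φ′(p_b) ∈ [Dlo_b, Dhi_b]`; every other label of the box is FAR for this `G` (`9/2 ≤ ‖latPt G f b‖`).  If `μ ≤ 2·(points-form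
checker expression)`, then `μ ≤ Σ_{b ∈ [−7,7]³∖0} W₄₅ ‖latPt G fccVec b‖` — the `hleaf` floor input of `…HomCover.homFloor_of_entryCover`. [folklore] -/
theorem boxSum_ge_of_nearPoints (S : Finset (Fin 3 → ℤ)) (f : Fin 3 → E3)
    (hS : S ⊆ (Fintype.piFinset fun _ : Fin 3 => Finset.Icc (-7 : ℤ) 7).filter (fun b => b ≠ 0)) (hdisj : ∀ b ∈ S, -b ∉ S)
    (lo hi M p V Dlo Dhi : (Fin 3 → ℤ) → ℝ) (c₀ w : Fin 9 → ℝ) (μ : ℝ) (hw : ∀ k, 0 ≤ w k) (hM : ∀ b ∈ S, 0 ≤ M b)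
    (hlo0 : ∀ b ∈ S, 0 < lo b)
    (hmono : ∀ b ∈ S, MonotoneOn (fun t => deriv (effPot w₄₅ ω₄ (3 / 400)) (Real.sqrt t) / (2 * Real.sqrt t) + M b * t) (Icc (lo b) (hi b)))
    (hp : ∀ b ∈ S, p b ∈ Icc (lo b) (hi b))
    (hlo : ∀ b ∈ S, lo b ≤ ∑ k, ((b ((@finProdFinEquiv 3 3).symm k).1 : ℝ) * (b ((@finProdFinEquiv 3 3).symm k).2 : ℝ)) * c₀ k -
        ∑ k, |((b ((@finProdFinEquiv 3 3).symm k).1 : ℝ) * (b ((@finProdFinEquiv 3 3).symm k).2 : ℝ))| * w k)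
    (hhi : ∀ b ∈ S, ∑ k, ((b ((@finProdFinEquiv 3 3).symm k).1 : ℝ) * (b ((@finProdFinEquiv 3 3).symm k).2 : ℝ)) * c₀ k +
        ∑ k, |((b ((@finProdFinEquiv 3 3).symm k).1 : ℝ) * (b ((@finProdFinEquiv 3 3).symm k).2 : ℝ))| * w k ≤ hi b)
    (hV : ∀ b ∈ S, V b ≤ effPot w₄₅ ω₄ (3 / 400) (Real.sqrt (p b)))
    (hD : ∀ b ∈ S, deriv (effPot w₄₅ ω₄ (3 / 400)) (Real.sqrt (p b)) / (2 * Real.sqrt (p b)) ∈ Icc (Dlo b) (Dhi b))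
    (hcheck : μ ≤ 2 * (∑ b ∈ S, V b
        + ∑ b ∈ S, min (Dlo b * (∑ k, ((b ((@finProdFinEquiv 3 3).symm k).1 : ℝ) * (b ((@finProdFinEquiv 3 3).symm k).2 : ℝ)) * c₀ k - p b))
            (Dhi b * (∑ k, ((b ((@finProdFinEquiv 3 3).symm k).1 : ℝ) * (b ((@finProdFinEquiv 3 3).symm k).2 : ℝ)) * c₀ k - p b))
        - ∑ k, max |∑ b ∈ S, min (Dlo b * (((b ((@finProdFinEquiv 3 3).symm k).1 : ℝ) * (b ((@finProdFinEquiv 3 3).symm k).2 : ℝ))))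
              (Dhi b * (((b ((@finProdFinEquiv 3 3).symm k).1 : ℝ) * (b ((@finProdFinEquiv 3 3).symm k).2 : ℝ))))|
            |∑ b ∈ S, max (Dlo b * (((b ((@finProdFinEquiv 3 3).symm k).1 : ℝ) * (b ((@finProdFinEquiv 3 3).symm k).2 : ℝ))))
              (Dhi b * (((b ((@finProdFinEquiv 3 3).symm k).1 : ℝ) * (b ((@finProdFinEquiv 3 3).symm k).2 : ℝ))))| * w k
        - 1 / 2 * ∑ b ∈ S, M b * (|∑ k, ((b ((@finProdFinEquiv 3 3).symm k).1 : ℝ) * (b ((@finProdFinEquiv 3 3).symm k).2 : ℝ)) * c₀ k - p b| +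
            ∑ k, |((b ((@finProdFinEquiv 3 3).symm k).1 : ℝ) * (b ((@finProdFinEquiv 3 3).symm k).2 : ℝ))| * w k) ^ 2))
    (G : E3 →L[ℝ] E3)
    (hbox : ∀ k : Fin 9, |⟪G (f ((@finProdFinEquiv 3 3).symm k).1), G (f ((@finProdFinEquiv 3 3).symm k).2)⟫ - c₀ k| ≤ w k)
    (hfar : ∀ b ∈ (Fintype.piFinset fun _ : Fin 3 => Finset.Icc (-7 : ℤ) 7).filter (fun b => b ≠ 0), b ∉ S → -b ∉ S →
      9 / 2 ≤ ‖latPt G f b‖) :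
    μ ≤ ∑ b ∈ (Fintype.piFinset fun _ : Fin 3 => Finset.Icc (-7 : ℤ) 7).filter (fun b => b ≠ 0), effPot w₄₅ ω₄ (3 / 400) ‖latPt G f b‖ := by
  -- fold the box sum onto `S`
  rw [sum_box7_eq_two_mul_sum S (fun b => effPot w₄₅ ω₄ (3 / 400) ‖latPt G f b‖) hS hdisj (fun b => by rw [norm_latPt_neg])
    (fun b hb h1 h2 => effPot45_eq_far (hfar b hb h1 h2))]
  -- the sum over `S` in Gram coordinates, by the points form
  have h := leaf_sound_points S
    (fun b k => ((b ((@finProdFinEquiv 3 3).symm k).1 : ℝ) * (b ((@finProdFinEquiv 3 3).symm k).2 : ℝ)))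
    (fun _ q => effPot w₄₅ ω₄ (3 / 400) (Real.sqrt q)) (fun _ t => deriv (effPot w₄₅ ω₄ (3 / 400)) (Real.sqrt t) / (2 * Real.sqrt t))
    lo hi M p V Dlo Dhi c₀ w (μ / 2) hw hM (fun b hb t ht => hasDerivAt_phi45 ((hlo0 b hb).trans_le ht.1)) hmono hp hlo hhi hV hD
    (by linarith) (fun k => ⟪G (f ((@finProdFinEquiv 3 3).symm k).1), G (f ((@finProdFinEquiv 3 3).symm k).2)⟫) hbox
  simp only [← summand_eq_gram] at h
  linarith

end Summit.AtomisticToContinuum.Crystallization.Theorems.FrustratedLawDichotomyStrainedPatchHomLeafPoints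

end
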